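import Literature.Barriers.ValiantsHypothesis.MonotoneGapDecomposition
import Literature.Barriers.ValiantsHypothesis.MonotoneGapRectangle
import Literature.Combinatorics.Enumerative.CayleyForests
import Literature.Barriers.ValiantsHypothesis.MonotoneGapUpper
import HarnessLib

/-!
# The monotone gap, proofs (3): Jerrum–Snir's exponential monotone lower bound for `ST`

Sibling of `Literature/Barriers/ValiantsHypothesis/MonotoneGap.lean`; discharges the named fact
`JerrumSnir1982_spanningTree` stated there (`JerrumSnir1982_spanningTree_holds`): there are
`c > 0` and `N₀` (here `c = 1/20`, `N₀ = 60`) such that every monotone computation of the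
spanning tree polynomial `ST` on `N + 1` nodes, `N ≥ N₀`, has at least `2^{cN}` product gates.

**Proof** (Jerrum–Snir 1982, §4.5, with the balanced decomposition in place of the exact weight
recursion of §3; this is also the computation of [ChattopadhyayDattaGhosalMukhopadhyay2022, §3]
for the complete graph).

1. `card_arborescences`: `|mon(ST)| = (N+1)^{N-1}` — the arborescences of `MonotoneGap.lean`
   are the rooted forests of `Literature.Combinatorics.Enumerative.CayleyForests` on
   `Option (Fin N)` with the single root `none` (`isForestOn_parentMap_iff`, the bridge asked for
   in the review of p21726), counted by Cayley's formula `card_forests_univ_singleton`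
   ("`|mon(p)| = n^{n-2}` [13]" in JS §4.5).
2. `MonotoneGapDecomposition`: `ST = Σ_{j<J} a_j b_j`, `J ≤ prodCount P`, `m < deg a_j ≤ 2m`,
   `m = ⌊N/3⌋`. (The tree's `Computability/AlgebraicComplexity/MonotoneStructure.lean` has the
   balanced decomposition `ArithCircuit.exists_balanced_decomposition` with at most
   `4 · size · (n+1)²` terms; the `⊗`-complexity statement needs the product-gate count, hence
   the sibling file.)
3. `MonotoneGapRectangle.card_support_mul_le`: `|mon(a_j b_j)| ≤ ((N + k² + (N-k)² + k(N-k))/N)^N`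
   with `k = deg a_j`; for `N/3 < k ≤ 2N/3` this is at most `(1 + 8N/9)^N` (`nine_mul_bound_le`).
4. Hence `(N+1)^{N-1} ≤ prodCount P · (1 + 8N/9)^N`, and
   `(N+1)^{N-1} / (1 + 8N/9)^N = (9(N+1)/(8N+9))^N / (N+1) ≥ (28/25)^N / (N+1) ≥ 2^{N/20}` for
   `N ≥ 60` (`2^{1/20} ≤ 26/25`, `N + 1 ≤ (14/13)^N`, `26·14 / (25·13) = 28/25`).

## References

* [JerrumSnir1982] M. Jerrum, M. Snir, *Some exact complexity results for straight-line
  computations over semirings*, J. ACM 29 (1982) 874–897, §4.5 (pp. 891–892), §5.1 (p. 893).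
* [ChattopadhyayDattaGhosalMukhopadhyay2022] A. Chattopadhyay, R. Datta, U. Ghosal,
  P. Mukhopadhyay, *Monotone complexity of spanning tree polynomial re-visited*, ITCS 2022, §3.
* [AignerZiegler1998] M. Aigner, G. M. Ziegler, *Proofs from THE BOOK*, Springer 1998, Ch. 26.
-/

noncomputable section

namespace Literature.Barriers.ValiantsHypothesis

open Literature.Computability.AlgebraicComplexity MvPolynomial Finset
open Literature.Combinatorics.Enumerative
open scoped NNReal

/-! ### Counting arborescences: the bridge to Cayley's formula -/

section Count

variable {N : ℕ}

/-- An arborescence of `MonotoneGap.lean` is exactly a rooted forest (parent map) on all of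
`Option (Fin N)` with the single root `none`. [cite: AignerZiegler1998, Ch. 26] -/
theorem isForestOn_parentMap_iff (t : Fin N → Option (Fin N)) :
    IsForestOn (Finset.univ : Finset (Option (Fin N))) {none} (parentMap t) ↔
      IsArborescence t := by
  constructor
  · rintro ⟨-, h⟩ i
    obtain ⟨n, hn⟩ := h (some i) (mem_univ _)
    exact ⟨n, mem_singleton.mp hn⟩
  · intro ht
    refine ⟨fun v hv => ?_, fun v _ => ?_⟩
    · have : v = none := by simpa using hv
      subst this
      rfl
    · cases v with
      | none => exact ⟨0, by simp⟩
      | some i =>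
        obtain ⟨n, hn⟩ := ht i
        exact ⟨n, by rw [hn]; exact mem_singleton_self _⟩

/-- The parent map of `T ∘ some` is `T` when `T` fixes the root. [folklore] -/
theorem parentMap_comp_some {T : Option (Fin N) → Option (Fin N)} (hT : T none = none) :
    parentMap (T ∘ some) = T := by
  funext v
  cases v with
  | none => exact hT.symm
  | some i => rfl

/-- **Cayley's formula for `ST`:** the complete graph on `N + 1` nodes has `(N+1)^{N-1}`
arborescences with a fixed root ("`|mon(p)| = n^{n-2}`"). [cite: JerrumSnir1982, §4.5] [cite: AignerZiegler1998, Ch. 26 (Theorem)] -/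
theorem card_arborescences (N : ℕ) : (arborescences N).card = (N + 1) ^ (N - 1) := by
  have h := card_forests_univ_singleton (α := Option (Fin N)) none
  rw [Fintype.card_option, Fintype.card_fin, show N + 1 - 2 = N - 1 by omega] at h
  rw [← h]
  refine Finset.card_nbij' parentMap (fun T => T ∘ some) ?_ ?_ ?_ ?_
  · intro t ht
    rw [mem_coe, mem_arborescences] at ht
    rw [mem_coe, mem_forests]
    exact (isForestOn_parentMap_iff t).mpr ht
  · intro T hT
    rw [mem_coe, mem_forests] at hT
    rw [mem_coe, mem_arborescences]
    have hT0 : T none = none := hT.1 none (by simp)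
    rw [← isForestOn_parentMap_iff, parentMap_comp_some hT0]
    exact hT
  · intro t _
    rfl
  · intro T hT
    rw [mem_coe, mem_forests] at hT
    exact parentMap_comp_some (hT.1 none (by simp))

/-- `|mon(ST_N)| = (N+1)^{N-1}` over any nontrivial semiring. [cite: JerrumSnir1982, §4.5] -/
theorem card_support_stPoly_eq (R : Type*) [CommSemiring R] [Nontrivial R] (N : ℕ) :
    (stPoly R N).support.card = (N + 1) ^ (N - 1) := by
  rw [card_support_stPoly, card_arborescences]

end Count

/-! ### Sums of products: supports -/

section Sums

variable {σ : Type*}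

/-- A summand of a list sum splits off. [folklore] -/
theorem exists_sum_eq_add_of_mem {M : Type*} [AddCommMonoid M] {β : Type*} (f : β → M) :
    ∀ (L : List β) (b : β), b ∈ L → ∃ q : M, (L.map f).sum = f b + q := by
  intro L
  induction L with
  | nil => intro b hb; simp at hb
  | cons a L ih =>
    intro b hb
    rcases List.mem_cons.mp hb with rfl | hb
    · exact ⟨(L.map f).sum, by simp⟩
    · obtain ⟨q, hq⟩ := ih b hb
      exact ⟨f a + q, by simp [hq]; abel⟩

/-- The number of monomials of a sum of products is at most the sum of the numbers of monomials
(over `ℝ≥0` it is the cardinality of the union). [folklore] -/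
theorem card_support_sum_le (L : List (MvPolynomial σ ℝ≥0 × MvPolynomial σ ℝ≥0)) (B : ℝ)
    (hB : ∀ ab ∈ L, ((ab.1 * ab.2).support.card : ℝ) ≤ B) :
    (((L.map fun ab : MvPolynomial σ ℝ≥0 × MvPolynomial σ ℝ≥0 => ab.1 * ab.2).sum).support.card :
      ℝ) ≤ L.length * B := by
  classical
  induction L with
  | nil => simp
  | cons ab L ih =>
    simp only [List.map_cons, List.sum_cons, List.length_cons, Nat.cast_succ]
    have h1 := hB ab List.mem_cons_self
    have h2 := ih (fun ab' h => hB ab' (List.mem_cons_of_mem _ h))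
    set rest := (L.map fun ab : MvPolynomial σ ℝ≥0 × MvPolynomial σ ℝ≥0 => ab.1 * ab.2).sum
      with hrest
    have h3 : ((ab.1 * ab.2 + rest).support.card : ℝ) ≤
        ((ab.1 * ab.2).support.card : ℝ) + rest.support.card := by
      exact_mod_cast (card_le_card (support_add (p := ab.1 * ab.2) (q := rest))).trans
        (card_union_le _ _)
    calc _ ≤ ((ab.1 * ab.2).support.card : ℝ) + rest.support.card := h3
      _ ≤ B + L.length * B := add_le_add h1 h2
      _ = (L.length + 1) * B := by ring

end Sums

/-! ### Arithmetic -/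

section Arithmetic

/-- For `N/3 < k ≤ 2⌊N/3⌋` (so `k, N - k ≥ N/3`): `9 (N + k² + (N-k)² + k(N-k)) ≤ 9N + 8N²`,
i.e. `k (N - k) ≥ N²/9`. [folklore] -/
theorem nine_mul_bound_le {N k : ℕ} (hk : N / 3 < k) (hk2 : k ≤ 2 * (N / 3)) :
    9 * (N + k ^ 2 + (N - k) ^ 2 + k * (N - k)) ≤ 9 * N + 8 * N ^ 2 := by
  obtain ⟨u, hu⟩ : ∃ u, N - k = u := ⟨_, rfl⟩
  have hN : N = k + u := by omega
  have hku : k ≤ 2 * u := by omega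
  have huk : u ≤ 2 * k := by omega
  rw [hu, hN]
  have h1 : k * k ≤ 2 * u * k := Nat.mul_le_mul_right k hku
  have h2 : u * u ≤ 2 * k * u := Nat.mul_le_mul_right u huk
  nlinarith [h1, h2]

/-- `2^{N/20} ≤ (26/25)^N`, from `2 ≤ (26/25)^{20}`. [folklore] -/
theorem two_rpow_div_twenty_le (N : ℕ) : (2 : ℝ) ^ ((1 / 20 : ℝ) * N) ≤ (26 / 25 : ℝ) ^ N := by
  have h2 : (2 : ℝ) ≤ (26 / 25 : ℝ) ^ (20 : ℕ) := by norm_num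
  have hexp : 0 ≤ (1 / 20 : ℝ) * N := by positivity
  calc (2 : ℝ) ^ ((1 / 20 : ℝ) * N) ≤ ((26 / 25 : ℝ) ^ (20 : ℕ)) ^ ((1 / 20 : ℝ) * N) :=
        Real.rpow_le_rpow (by norm_num) h2 hexp
    _ = (26 / 25 : ℝ) ^ N := by
        rw [← Real.rpow_natCast (26 / 25 : ℝ) 20, ← Real.rpow_mul (by norm_num),
          show ((20 : ℕ) : ℝ) * ((1 / 20 : ℝ) * N) = (N : ℝ) by push_cast; ring,
          Real.rpow_natCast]

/-- `N + 1 ≤ (14/13)^N` for `N ≥ 60`. [folklore] -/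
theorem succ_le_pow_of_sixty_le {N : ℕ} (hN : 60 ≤ N) : ((N : ℝ) + 1) ≤ (14 / 13 : ℝ) ^ N := by
  induction N, hN using Nat.le_induction with
  | base => norm_num
  | succ n hn ih =>
    rw [pow_succ]
    push_cast
    have hn' : (60 : ℝ) ≤ n := by exact_mod_cast hn
    nlinarith [ih, hn']

/-- `28/25 ≤ 9(N+1)/(9 + 8N)` for `N ≥ 27`. [folklore] -/
theorem ratio_ge {N : ℕ} (hN : 27 ≤ N) :
    (28 / 25 : ℝ) ≤ 9 * ((N : ℝ) + 1) / (9 + 8 * N) := by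
  have hN' : (27 : ℝ) ≤ N := by exact_mod_cast hN
  rw [le_div_iff₀ (by positivity)]
  linarith

end Arithmetic

/-! ### The theorem -/

/-- **Jerrum–Snir 1982, §4.5 (discharge of `JerrumSnir1982_spanningTree`).** Every monotone
computation of the spanning tree polynomial `ST` on `N + 1 ≥ 61` nodes has at least `2^{N/20}`
product gates: "a crude bound on the content of a node, which, however, is good enough to yield
an exponential lower bound on the `⊗`-complexity of `ST_{n×n}`"; "any monotone arithmetic
computation for the spanning tree polynomial requires at least `n^{-1}(4/3)^{n-1}`
multiplications" (§5.1; the constant here, `2^{1/20}` from the `1/3–2/3` balanced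
decomposition, is weaker than the printed `4/3` from the exact weight recursion, as the vendored
statement allows). [cite: JerrumSnir1982, §4.5 and §5.1] -/
theorem JerrumSnir1982_spanningTree_holds : JerrumSnir1982_spanningTree := by
  refine ⟨1 / 20, by norm_num, 60, fun N hN P hP => ?_⟩
  -- (1) the balanced decomposition with `m = ⌊N/3⌋`
  have hm1 : 1 ≤ N / 3 := by omega
  have hmN : N / 3 < N := by omega
  obtain ⟨L, hLlen, hLsum, hLdeg⟩ :=
    hP.exists_decomposition hm1 hmN (stPoly_isHomogeneous ℝ≥0 N)
  -- (2) every product has few monomials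
  have hN1 : 1 ≤ N := by omega
  have hNpos : (0 : ℝ) < N := by exact_mod_cast hN1
  set r : ℝ := (9 + 8 * N) / 9 with hr
  have hrpos : 0 < r := by positivity
  have hterm : ∀ ab ∈ L, ((ab.1 * ab.2).support.card : ℝ) ≤ r ^ N := by
    intro ab hab
    by_cases hb : ab.2 = 0
    · simp only [hb, mul_zero, support_zero, card_empty, Nat.cast_zero]
      positivity
    have hdeg := hLdeg ab hab
    have ha : ab.1 ≠ 0 := by
      intro ha
      rw [ha, totalDegree_zero] at hdeg
      omega
    have hsub : (ab.1 * ab.2).support ⊆ (stPoly ℝ≥0 N).support := by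
      obtain ⟨q, hq⟩ := exists_sum_eq_add_of_mem (fun ab : MvPolynomial _ ℝ≥0 × _ => ab.1 * ab.2)
        L ab hab
      exact support_subset_of_eq_add (hLsum.trans hq)
    obtain ⟨hkN, hcard⟩ := card_support_mul_le hN1 hsub ha hb
    refine hcard.trans (pow_le_pow_left₀ (by positivity) ?_ N)
    -- `T / N ≤ r`
    have hT := nine_mul_bound_le hdeg.1 hdeg.2
    rw [div_le_iff₀ hNpos, hr]
    have hT' : (9 : ℝ) * ((N + ab.1.totalDegree ^ 2 + (N - ab.1.totalDegree) ^ 2 +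
        ab.1.totalDegree * (N - ab.1.totalDegree) : ℕ) : ℝ) ≤ 9 * N + 8 * (N : ℝ) ^ 2 := by
      exact_mod_cast hT
    nlinarith [hT']
  -- (3) counting monomials: `(N+1)^(N-1) ≤ prodCount P · r^N`
  have hcount : ((N : ℝ) + 1) ^ (N - 1) ≤ prodCount P * r ^ N := by
    have h1 := card_support_sum_le L (r ^ N) hterm
    rw [← hLsum, card_support_stPoly_eq] at h1
    push_cast at h1
    refine h1.trans ?_
    gcongr
  -- (4) arithmetic: `2^(N/20) (N+1) r^N ≤ (N+1)^N`
  have hq : (28 / 25 : ℝ) ≤ 9 * ((N : ℝ) + 1) / (9 + 8 * N) := ratio_ge (by omega)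
  have hqr : 9 * ((N : ℝ) + 1) / (9 + 8 * N) * r = N + 1 := by
    rw [hr]; field_simp
  have hkey : (2 : ℝ) ^ ((1 / 20 : ℝ) * N) * ((N : ℝ) + 1) * r ^ N ≤ ((N : ℝ) + 1) ^ N := by
    calc (2 : ℝ) ^ ((1 / 20 : ℝ) * N) * ((N : ℝ) + 1) * r ^ N
        ≤ (26 / 25 : ℝ) ^ N * (14 / 13 : ℝ) ^ N * r ^ N := by
          gcongr
          · exact two_rpow_div_twenty_le N
          · exact succ_le_pow_of_sixty_le hN
      _ = (28 / 25 : ℝ) ^ N * r ^ N := by rw [← mul_pow]; norm_num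
      _ ≤ (9 * ((N : ℝ) + 1) / (9 + 8 * N)) ^ N * r ^ N := by gcongr
      _ = ((N : ℝ) + 1) ^ N := by rw [← mul_pow, hqr]
  -- combine
  have hpow : ((N : ℝ) + 1) ^ N = ((N : ℝ) + 1) * ((N : ℝ) + 1) ^ (N - 1) := by
    rw [← pow_succ']; congr 1; omega
  rw [hpow] at hkey
  have hN1' : (0 : ℝ) < (N : ℝ) + 1 := by positivity
  -- cancel `N + 1`, then `r ^ N`
  have h5 : (2 : ℝ) ^ ((1 / 20 : ℝ) * N) * r ^ N ≤ ((N : ℝ) + 1) ^ (N - 1) := by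
    have := hkey
    rw [mul_comm ((2 : ℝ) ^ _) ((N : ℝ) + 1), mul_assoc] at this
    exact le_of_mul_le_mul_left this hN1'
  have h6 : (2 : ℝ) ^ ((1 / 20 : ℝ) * N) * r ^ N ≤ prodCount P * r ^ N := h5.trans hcount
  exact le_of_mul_le_mul_right h6 (pow_pos hrpos N)

/-! ### The barrier fact `MonotoneGap` (discharge)

With both halves in the tree — the monotone lower bound `JerrumSnir1982_spanningTree_holds`
above (Jerrum–Snir 1982, §4.5) and `ST ∈ VP` over every field, `isVPFamily_stPoly_holds`
(`MonotoneGapUpper.lean`: the directed matrix-tree theorem `det_stLaplacian` of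
`MonotoneGapMatrixTree.lean` composed with Berkowitz's determinant circuit
`complexity_detPoly_le` of `DetInVP.lean`; Jerrum–Snir 1982, §5.1) — the barrier fact
`MonotoneGap := JerrumSnir1982_spanningTree ∧ isVPFamily_stPoly` of `MonotoneGap.lean` is a
theorem, and the no-go `¬ MonotoneLowerBoundsTransfer` becomes unconditional. -/

/-- **Discharge of the barrier fact `MonotoneGap` (Valiant 1980; Jerrum–Snir 1982, §4.5 and
§5.1).** The spanning tree family has exponential monotone `⊗`-complexity
(`JerrumSnir1982_spanningTree_holds`) and lies in `VP` over every field
(`isVPFamily_stPoly_holds`). [cite: JerrumSnir1982, §4.5 and §5.1] -/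
theorem MonotoneGap_holds : MonotoneGap :=
  ⟨JerrumSnir1982_spanningTree_holds, isVPFamily_stPoly_holds⟩

/-- **The no-go theorem, unconditionally**: exponential monotone lower bounds do not transfer to
`VP` (the transfer class `MonotoneLowerBoundsTransfer` of `MonotoneGap.lean` is empty).
[cite: JerrumSnir1982, §4.5 and §5.1] -/
theorem not_monotoneLowerBoundsTransfer_holds : ¬ MonotoneLowerBoundsTransfer :=
  MonotoneGap_holds.not_monotoneLowerBoundsTransfer

end Literature.Barriers.ValiantsHypothesis
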